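import Summits.NavierStokesRegularity.NavierStokesRegularity.Theses.SqueezeCycle
import Summits.NavierStokesRegularity.NavierStokesRegularity.Theorems.SqueezeCycleExtremalBiaxialitySubcriticalOfLiouville
import Summits.NavierStokesRegularity.NavierStokesRegularity.Theorems.SqueezeCycleExtremalBiaxialitySubcriticalReductions
import Summits.NavierStokesRegularity.NavierStokesRegularity.Theorems.SqueezeCycleExtremalBiaxialitySubcriticalExtremal
import Summits.NavierStokesRegularity.NavierStokesRegularity.Theorems.SqueezeCycleExtremalElementExists
import Summits.NavierStokesRegularity.NavierStokesRegularity.Theorems.SqueezeCycleExtremalBiaxialitySubcriticalGaugeStrainBound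
import Summits.NavierStokesRegularity.NavierStokesRegularity.Theorems.SqueezeCycleExtremalBiaxialitySubcriticalStretchRecordAttained
import Summits.NavierStokesRegularity.NavierStokesRegularity.Theorems.SqueezeCycleExtremalBiaxialitySubcriticalStretchRecordBudget
import Summits.NavierStokesRegularity.NavierStokesRegularity.Theorems.SqueezeCycleExtremalBiaxialitySubcriticalPayerTomography
import Summits.NavierStokesRegularity.NavierStokesRegularity.Theorems.SqueezeCycleExtremalBiaxialitySubcriticalNoSlackStretching
import Literature.Analysis.FluidPDE.TypeIAncientMild
import Literature.Analysis.FluidPDE.TypeIAncientMildClassical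
import Literature.Analysis.FluidPDE.LerayGaugeStrainSpectrum
import Literature.Analysis.FluidPDE.DeviatoricHessian
import Literature.Analysis.FluidPDE.ClassicalSolution
import HarnessLib

/-!
# Crux `ExtremalBiaxialitySubcritical` (stmt-NavierStokesRegularity-11609) — line `oseen-shell-polar-tomography`, lead skeleton

Lead skeleton of line `oseen-shell-polar-tomography` (idea card of crux-ideator 1; crux-plan
skeleton registered 2026-08-16T00:08:02Z, sha cf6cbea9, six stubs). Rebuilt by the SECOND line
lead (prover-line-stmt-NavierStokesRegularity-11609-b-0) VERBATIM from the six stub signatures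
archived on the ledger (archive ids 8222–8227; the planner's skeleton/card files live only under
run/gate/evidence and run/sessions/planner-*, neither mounted in the lead's jail); the
composition `ExtremalBiaxialitySubcritical_of` is the lead's.

THE LINE (stretch alternative of the card, triage r1-1/r1-3 "sharpen"). Suppose an extremal
configuration with `m ≥ 1/8` exists. The class `𝒦_C` is then nontrivial, and:
1. `stub_stretchRecordAttained` — the class-wide supremum `M` of the Leray-gauge STRETCHING rate
   `(−t)⟪∇v(t,x)e, e⟫` (`v ∈ 𝒦_C`, `t < 0`, `x`, `‖e‖ = 1`; i.e. of `(−t)λ₁(sym ∇v)`) is attained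
   by some `(u₁, t₁, x₁, e₁)` (twin of the proved item `ExtremalElementExists`: KNSS compactness
   of the class + zoom invariance + compactness of the unit sphere).
2. `stub_noSlackStretching` — NO SLACK: an element with gauge stretching `≤ 1 − ε` everywhere
   vanishes (the vorticity modulus `|ω|² (−t)^{2(1−ε)}` is a bounded subsolution of the drift–heat
   equation; whole-space maximum principle from `t → −∞`, where the KNSS gauge bound
   `(−t)|ω| ≤ C₁` kills it; `ω ≡ 0` ⇒ bounded harmonic slices ⇒ `u ≡ 0` in the KNSS gauge).
   Hence `M ≥ 1` for a nontrivial class.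
3. `stub_noPancakeRecord` — at a class-maximal squeeze record `m ≥ 1/8`, `3m ≤ M` (free for
   `m ≤ 1/3` by 2.; the content is at `m > 1/3`: OPEN).
4. `stub_stretchRecordBudget` — first/second-order conditions at the space-time maximum of
   `(−t)S_ee` plus the strain equation `D_t S = −S² − ¼(ω⊗ω − |ω|²I) − ∇²p + ΔS` and
   `Δp = ½|ω|² − |S|²`, with the ceiling `Λ ≤ m` bounding the isotropic part:
   `⅓M² + M(1 − ⅔m) − ⅔m² ≤ −(−t)²ℌ^dev_ee + ((−t)²|ω|² − ((−t)ω·e)²)/12 − ((−t)ω·e)²/6`.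
5. `stub_payerTomography` — the deviatoric pressure Hessian in gauge is, up to `ε`, the TRUNCATED
   polar-quadrupole (P₂) transform of `tr(∇u)² = |S|² − ½|ω|²` over the ball of gauge radius `K`
   (Oseen far-shell bound from the Type-I sup rate: the shell `|z| > K√(−t)` and the sphere
   boundary terms contribute `O(C²/K² + C·C₁/K)`).
6. `stub_coaxialFeederExclusion` — OPEN, hardest (held by the lead): at a class-wide stretching
   record under the squeeze ceiling, the truncated quadrupole payer plus the local vorticity
   terms fall short of the bill by some `δ > 0`, uniformly in `K ≥ 1`.
Composition: 6 gives `δ`, 5 with `ε = δ/2` gives `K`, the classical pressure on a window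
through `t₁` exists (`IsTypeIAncientMild.exists_isClassicalNSSolutionOn_Ioo`), and 4 + 5 + 6 at
`K` are contradictory; so `m < 1/8`.

Registered stubs: six at registration (2026-08-16T03:10Z); after wave 1 four are theorems of the tree and
imported, two remain below as `sorry` (the pair is equivalent to the crux, see
`Theorems/SqueezeCycleExtremalBiaxialitySubcriticalFeederReduction.lean`).
-/

noncomputable section

open MeasureTheory Set Filter Topology
open scoped RealInnerProductSpace Matrix

set_option linter.dupNamespace false

namespace Summit.NavierStokesRegularity.NavierStokesRegularity.Theorems

open Literature.Analysis.FluidPDE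
open Summit.NavierStokesRegularity.NavierStokesRegularity.Theses.SqueezeCycle

/-- Physical space `ℝ³`. -/
local notation "ℝ³" => EuclideanSpace ℝ (Fin 3)

/-! ## Registered stubs

LANDED (imported): `stub_stretchRecordAttained` (p81985), `stub_noSlackStretching` (p94840),
`stub_stretchRecordBudget` (p80708), `stub_payerTomography` (p91020 + helper files p82861/p86864/p87481/p90446).
OPEN (the only `sorry`s): `stub_coaxialFeederExclusion` (lead), `stub_noPancakeRecord` (reshaped to `m > 1/3`). -/

/-- **stub_coaxialFeederExclusion** (OPEN — the hardest stub, held by the lead): at a class-wide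
stretching record `(u₁, t₁, x₁, e₁, M)` of `𝒦_C` under the class-wide squeeze ceiling `Λ ≤ m`,
with `1/8 ≤ m`, `3m ≤ M`, `1 ≤ M`, the truncated polar-quadrupole payer plus the local vorticity
terms fall short of the stretch-record bill `⅓M² + M(1 − ⅔m) − ⅔m²` by some `δ > 0`, uniformly in
the gauge radius `K ≥ 1`. (Card: the only positive near-field payer is a vorticity-dominated
structure in the polar cone of `e₁` — a COAXIAL FEEDER — or strain excess in the equatorial belt;
the card argues such a feeder makes the record configuration nearly axisymmetric about `e₁`,
handing over to the axisymmetric Type-I exclusions. No theorem supplies that handover; given the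
other five stubs this statement is equivalent to the crux.) -/
theorem stub_coaxialFeederExclusion :
    ∀ (C m : ℝ) (u₁ : ℝ → EuclideanSpace ℝ (Fin 3) → EuclideanSpace ℝ (Fin 3)) (t₁ : ℝ) (x₁ e₁ : EuclideanSpace ℝ (Fin 3)) (M : ℝ), ((IsTypeIAncientMild C u₁ ∧ (∀ (x₀ : EuclideanSpace ℝ (Fin 3)) (t₀ r : ℝ), t₀ ≤ 0 → 0 < r → (∀ t, t₀ - r^2 < t → t < t₀ → r⁻¹ * ∫ x in Metric.ball x₀ r, ‖u₁ t x‖^2 ≤ C) ∧ r⁻¹ * ∫ t in Set.Ioo (t₀ - r^2) t₀, ∫ x in Metric.ball x₀ r, ‖fderiv ℝ (u₁ t) x‖^2 ≤ C)) ∧ t₁ < 0 ∧ ‖e₁‖ = 1 ∧ (-t₁) * inner ℝ (fderiv ℝ (u₁ t₁) x₁ e₁) e₁ = M ∧ (∀ v : ℝ → EuclideanSpace ℝ (Fin 3) → EuclideanSpace ℝ (Fin 3), (IsTypeIAncientMild C v ∧ (∀ (x₀ : EuclideanSpace ℝ (Fin 3)) (t₀ r : ℝ), t₀ ≤ 0 →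 0 < r → (∀ t, t₀ - r^2 < t → t < t₀ → r⁻¹ * ∫ x in Metric.ball x₀ r, ‖v t x‖^2 ≤ C) ∧ r⁻¹ * ∫ t in Set.Ioo (t₀ - r^2) t₀, ∫ x in Metric.ball x₀ r, ‖fderiv ℝ (v t) x‖^2 ≤ C)) → ∀ t < 0, ∀ (x e : EuclideanSpace ℝ (Fin 3)), ‖e‖ = 1 → (-t) * inner ℝ (fderiv ℝ (v t) x e) e ≤ M)) → (∀ v : ℝ → EuclideanSpace ℝ (Fin 3) → EuclideanSpace ℝ (Fin 3), (IsTypeIAncientMild C v ∧ (∀ (x₀ : EuclideanSpace ℝ (Fin 3)) (t₀ r : ℝ), t₀ ≤ 0 → 0 < r → (∀ t, t₀ - r^2 < t → t < t₀ → r⁻¹ * ∫ x in Metric.ball x₀ r, ‖v t x‖^2 ≤ C) ∧ r⁻¹ * ∫ t in Set.Ioo (t₀ - r^2) t₀, ∫ x in Metric.ball x₀ r, ‖fderiv ℝ (v t) x‖^2 ≤ C)) → ∀ t < 0, ∀ x : EuclideanSpace ℝ (Fin 3), lerayMiddleStrain v t x ≤ m) → 1 / 8 ≤ m → 3 * m ≤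 M → 1 ≤ M → ∃ δ : ℝ, 0 < δ ∧ ∀ K : ℝ, 1 ≤ K → (-t₁) ^ 2 * (∫ z in Metric.ball (0 : EuclideanSpace ℝ (Fin 3)) (K * Real.sqrt (-t₁)), (3 * inner ℝ z e₁ ^ 2 - ‖z‖ ^ 2) / (4 * Real.pi * ‖z‖ ^ 5) * (LinearMap.trace ℝ (EuclideanSpace ℝ (Fin 3)) ((fderiv ℝ (u₁ t₁) x₁).comp (fderiv ℝ (u₁ t₁) x₁)).toLinearMap - LinearMap.trace ℝ (EuclideanSpace ℝ (Fin 3)) ((fderiv ℝ (u₁ t₁) (x₁ - z)).comp (fderiv ℝ (u₁ t₁) (x₁ - z))).toLinearMap)) + ((-t₁) ^ 2 * ‖curl (u₁ t₁) x₁‖ ^ 2 - ((-t₁) * inner ℝ (curl (u₁ t₁) x₁) e₁) ^ 2) / 12 - ((-t₁) * inner ℝ (curl (u₁ t₁) x₁) e₁) ^ 2 / 6 ≤ M ^ 2 / 3 + M * (1 - 2 * m / 3) - 2 * m ^ 2 / 3 - δ := by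
  sorry

/-- **stub_noPancakeRecord** (OPEN; RESHAPED by the lead to the regime `m > 1/3` — for `m ≤ 1/3` the
inequality `3m ≤ M` is free from no-slack `M ≥ 1`, see the composition): at a class-maximal
squeeze record `m > 1/3` of `𝒦_C` (attained by `u` at `(t₀, x₀)`), every
class-wide stretching record `M` satisfies `3m ≤ M` — the squeeze record is not a "pancake"
(`λ₁ ≈ λ₂`) relative to the class's stretching scale. (Card: auto-squeeze branch of the
λ₂-record budget, `⅔(Λ₁ − m)(Λ₁ + 2m) ≥ m(1 − m)` forces `Λ₁ ≳ 3.07 m` at `m = 1/8` when no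
non-local payer is present; the hetero-squeezed pancake is not excluded by any theorem.) -/
theorem stub_noPancakeRecord :
    ∀ (C m : ℝ) (u : ℝ → EuclideanSpace ℝ (Fin 3) → EuclideanSpace ℝ (Fin 3)) (t₀ : ℝ) (x₀ : EuclideanSpace ℝ (Fin 3)), t₀ < 0 → (IsTypeIAncientMild C u ∧ (∀ (x₀ : EuclideanSpace ℝ (Fin 3)) (t₀ r : ℝ), t₀ ≤ 0 → 0 < r → (∀ t, t₀ - r^2 < t → t < t₀ → r⁻¹ * ∫ x in Metric.ball x₀ r, ‖u t x‖^2 ≤ C) ∧ r⁻¹ * ∫ t in Set.Ioo (t₀ - r^2) t₀, ∫ x in Metric.ball x₀ r, ‖fderiv ℝ (u t) x‖^2 ≤ C)) → m ≤ lerayMiddleStrain u t₀ x₀ → (∀ v : ℝ → EuclideanSpace ℝ (Fin 3) → EuclideanSpace ℝ (Fin 3), (IsTypeIAncientMild C v ∧ (∀ (x₀ : EuclideanSpace ℝ (Fin 3)) (t₀ r : ℝ), t₀ ≤ 0 → 0 < r → (∀ t, t₀ - r^2 < t → t < t₀ → r⁻¹ * ∫ x in Metric.ball x₀ r, ‖v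 t x‖^2 ≤ C) ∧ r⁻¹ * ∫ t in Set.Ioo (t₀ - r^2) t₀, ∫ x in Metric.ball x₀ r, ‖fderiv ℝ (v t) x‖^2 ≤ C)) → ∀ t < 0, ∀ x : EuclideanSpace ℝ (Fin 3), lerayMiddleStrain v t x ≤ m) → 1 / 8 ≤ m → 1 / 3 < m → ∀ (u₁ : ℝ → EuclideanSpace ℝ (Fin 3) → EuclideanSpace ℝ (Fin 3)) (t₁ : ℝ) (x₁ e₁ : EuclideanSpace ℝ (Fin 3)) (M : ℝ), ((IsTypeIAncientMild C u₁ ∧ (∀ (x₀ : EuclideanSpace ℝ (Fin 3)) (t₀ r : ℝ), t₀ ≤ 0 → 0 < r → (∀ t, t₀ - r^2 < t → t < t₀ → r⁻¹ * ∫ x in Metric.ball x₀ r, ‖u₁ t x‖^2 ≤ C) ∧ r⁻¹ * ∫ t in Set.Ioo (t₀ - r^2) t₀, ∫ x in Metric.ball x₀ r, ‖fderiv ℝ (u₁ t) x‖^2 ≤ C)) ∧ t₁ < 0 ∧ ‖e₁‖ = 1 ∧ (-t₁) * inner ℝ (fderiv ℝ (u₁ t₁) x₁ e₁) e₁ = M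 ∧ (∀ v : ℝ → EuclideanSpace ℝ (Fin 3) → EuclideanSpace ℝ (Fin 3), (IsTypeIAncientMild C v ∧ (∀ (x₀ : EuclideanSpace ℝ (Fin 3)) (t₀ r : ℝ), t₀ ≤ 0 → 0 < r → (∀ t, t₀ - r^2 < t → t < t₀ → r⁻¹ * ∫ x in Metric.ball x₀ r, ‖v t x‖^2 ≤ C) ∧ r⁻¹ * ∫ t in Set.Ioo (t₀ - r^2) t₀, ∫ x in Metric.ball x₀ r, ‖fderiv ℝ (v t) x‖^2 ≤ C)) → ∀ t < 0, ∀ (x e : EuclideanSpace ℝ (Fin 3)), ‖e‖ = 1 → (-t) * inner ℝ (fderiv ℝ (v t) x e) e ≤ M)) → 3 * m ≤ M := by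
  sorry

/-! ## Composition -/

/-- **`ExtremalBiaxialitySubcritical` from the six stubs** (line oseen-shell-polar-tomography).
Suppose `m ≥ 1/8` at an extremal configuration `(C, m, u, t₀, x₀)`. The inline class is
`IsTypeIAncientMild C` plus the scaled-energy clause (`isTypeIAncientMild_of_squeezeClass`,
`isTypeIAncientMild_iff`), the two two-frame clauses are `Λ_u(t₀,x₀) = m` and the class-wide
ceiling `Λ ≤ m` (`extremal_lerayMiddleStrain_eq`). Take a class-wide stretching record
`(u₁, t₁, x₁, e₁, M)` (`stub_stretchRecordAttained`); `M ≥ 1`, for otherwise `u` has stretching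
`≤ M = 1 − ε` everywhere and vanishes (`stub_noSlackStretching`), forcing `m ≤ 0`
(`nonpos_of_twoFrame_lower_of_slice_zero`); `3m ≤ M` (`stub_noPancakeRecord`). Let `δ > 0` be the
shortfall of `stub_coaxialFeederExclusion`, `K ≥ 1` the radius of `stub_payerTomography` at
`ε = δ/2`, and `p` a classical pressure of `u₁` on `(2t₁, 0)`
(`IsTypeIAncientMild.exists_isClassicalNSSolutionOn_Ioo`). Then the budget
(`stub_stretchRecordBudget`), the tomography at `(t₁, x₁, e₁)` and the shortfall at `K` read
`bill ≤ −ℌ + V`, `|−ℌ − I| ≤ δ/2`, `I + V ≤ bill − δ` — absurd. Hence `m < 1/8`. -/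
theorem ExtremalBiaxialitySubcritical_of :
    Summit.NavierStokesRegularity.NavierStokesRegularity.Theses.SqueezeCycle.ExtremalBiaxialitySubcritical := by
  intro C m u t₀ x₀ ht₀ hu hGE hmax
  by_contra hm
  replace hm : 1 / 8 ≤ m := not_lt.1 hm
  -- the two clauses in `lerayMiddleStrain` form (inline class)
  obtain ⟨hΛeq, hΛle⟩ := extremal_lerayMiddleStrain_eq ht₀ hu hGE hmax
  obtain ⟨h1, h2, h3, h4, h5⟩ := hu
  have hK : IsTypeIAncientMild C u := isTypeIAncientMild_of_squeezeClass h1 h2 h3 h4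
  -- the scaled-energy clause as a predicate, and the class bridge (tree class → inline class)
  set En : (ℝ → ℝ³ → ℝ³) → Prop := fun v =>
    ∀ (x₀ : EuclideanSpace ℝ (Fin 3)) (t₀ r : ℝ), t₀ ≤ 0 → 0 < r → (∀ t, t₀ - r^2 < t → t < t₀ → r⁻¹ * ∫ x in Metric.ball x₀ r, ‖v t x‖^2 ≤ C) ∧ r⁻¹ * ∫ t in Set.Ioo (t₀ - r^2) t₀, ∫ x in Metric.ball x₀ r, ‖fderiv ℝ (v t) x‖^2 ≤ C with hEn
  have hΛmax : ∀ v : ℝ → ℝ³ → ℝ³, (IsTypeIAncientMild C v ∧ En v) → ∀ t < 0, ∀ x : ℝ³,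
      lerayMiddleStrain v t x ≤ m := by
    rintro v ⟨hv, hve⟩ t ht x
    obtain ⟨a1, a2, a3, a4⟩ := isTypeIAncientMild_iff.1 hv
    exact hΛle v ⟨a1, a2, a3, a4, hve⟩ t ht x
  have hΛ0 : m ≤ lerayMiddleStrain u t₀ x₀ := hΛeq.ge
  -- ## 1. a class-wide stretching record
  obtain ⟨u₁, t₁, x₁, e₁, M, hrec⟩ := stub_stretchRecordAttained C u ⟨hK, h5⟩
  obtain ⟨⟨hK₁, h5₁⟩, ht₁, he₁, hMeq, hMmax⟩ := hrec
  -- ## 2. no slack: `M ≥ 1`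
  have hM1 : 1 ≤ M := by
    by_contra hM
    replace hM : M < 1 := not_le.1 hM
    have hz : ∀ x, u t₀ x = 0 := fun x =>
      stub_noSlackStretching C u hK (1 - M) (by linarith)
        (fun t ht x e he => by
          have h := hMmax u ⟨hK, h5⟩ t ht x e he
          linarith) t₀ ht₀ x
    have hm0 : m ≤ 0 := nonpos_of_twoFrame_lower_of_slice_zero hz hGE
    linarith
  -- ## 3. no pancake: `3m ≤ M` (free for `m ≤ 1/3` since `M ≥ 1`; the open stub otherwise)
  have h3m : 3 * m ≤ M := by
    by_cases hm3 : m ≤ 1 / 3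
    · linarith
    · exact stub_noPancakeRecord C m u t₀ x₀ ht₀ ⟨hK, h5⟩ hΛ0 hΛmax hm (not_le.1 hm3) u₁ t₁ x₁ e₁ M
        ⟨⟨hK₁, h5₁⟩, ht₁, he₁, hMeq, hMmax⟩
  -- ## 6. the shortfall `δ`
  obtain ⟨δ, hδ, hfeed⟩ := stub_coaxialFeederExclusion C m u₁ t₁ x₁ e₁ M
    ⟨⟨hK₁, h5₁⟩, ht₁, he₁, hMeq, hMmax⟩ hΛmax hm h3m hM1
  -- ## 5. the tomography radius `K` at `ε = δ/2`
  obtain ⟨K, hK1, htomo⟩ := stub_payerTomography C (δ / 2) (by positivity)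
  -- a classical pressure for `u₁` on the window `(2t₁, 0) ∋ t₁`
  have h2t₁ : 2 * t₁ < 0 := by linarith
  obtain ⟨p, hp⟩ := hK₁.exists_isClassicalNSSolutionOn_Ioo h2t₁
  -- ## 4. the budget at the record, the tomography there, and the shortfall at `K`
  have hbud := stub_stretchRecordBudget C m u₁ hK₁ t₁ ht₁ x₁ e₁ he₁ M hMeq
    (fun t ht x => hMmax u₁ ⟨hK₁, h5₁⟩ t ht x e₁ he₁)
    (fun e' he' => hMmax u₁ ⟨hK₁, h5₁⟩ t₁ ht₁ x₁ e' he')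
    (hΛmax u₁ ⟨hK₁, h5₁⟩ t₁ ht₁ x₁) (2 * t₁) (by linarith) p hp
  have htom := htomo u₁ hK₁ (2 * t₁) p hp t₁ (by linarith) ht₁ x₁ e₁ he₁
  have hsh := hfeed K hK1
  rw [abs_le] at htom
  linarith [htom.1, htom.2]

end Summit.NavierStokesRegularity.NavierStokesRegularity.Theorems

end
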